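import Summits.MatrixMultiplication.OmegaCensus.ThreeSetZ5Z13MomentCertificate
import HarnessLib

/-!
# `𝔽₁₃` test-vector certificates for the DOMINO fibre-moment system over `ℤ₅ × ℤ₅` (`W = {0}`)

ω-census `pub-omega`, family (b3), seat pub-omega-group gen 37.  Framing: lottery ticket; floor = certified bounds/negative
ranges.  VALUE: the moment-stage kernel check for the census cell `(1,9,12)@325` of `ℤ₅ × ℤ₆₅` (design
`HOME/pub-omega-group-g37/DESIGN-1-9-12.md`): the `W = {0}` twin of `ThreeSetZ5Z13MomentCertificate.lean`; NOT progress on ω.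

Setting.  For a domino cube form translated to `W = {0}`, the fibre sums of `Ψ : A →+ ZMod 13` over `W` vanish identically, so the collected
fibre-moment identities (`ThreeSetFibreMoment`) read, with `Wc = 𝟙_{0}` (`zc t0list`), `Xc = zc e`, `Yc = zc h` pinned by the plane stage and
hole `sb`:  `Σ_r Xs r·β(t,r) + Σ_u Ys u·γ(t,u) + [t = sb]·s₀ = 0` for every `t`.  A test vector `λ` with `Σ_t λ_t β(t,r) = [r = r₀]` on the
support of `e`, `Σ_t λ_t γ(t,u) = 0` on the support of `h` and `λ_{sb} = 0` isolates `Xs r₀` and forces it to vanish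
(**`Xs_eq_zero_of_momentCert1`**); with all fibres of `X` singletons this pins `Ψ` to `0` on `X`, after which a counting argument
(the number of zeros of `Ψ` on `A ∖ {x₀}` would be a multiple of `27`) closes the cell (design §4).
-/

namespace Summit.MatrixMultiplication.OmegaCensus

namespace Z5Z5ThreeSet

open Finset ZpZpDomino FibreMoment

/-- The indicator list of `{(0,0)}` in the point numbering `5u₁ + u₂`. [folklore] -/
def t0list : List ℕ := [1, 0, 0, 0, 0, 0, 0, 0, 0, 0, 0, 0, 0, 0, 0, 0, 0, 0, 0, 0, 0, 0, 0, 0, 0]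

/-- `Σ_t λ_t·β(t,r)` for `Wc = zc t0list`, `Yc = zc h` (single-sum form of `momB`). [folklore] -/
def accB1 (h L : List ℕ) (r : ZMod 5 × ZMod 5) : ZMod 13 :=
  ∑ t : ZMod 5 × ZMod 5, lamFn L t * ∑ v : ZMod 5 × ZMod 5, zc t0list v * (zc h (t + v - r) - zc h (r + t - v) + zc h (r - t + v))

/-- `Σ_t λ_t·γ(t,u)` for `Wc = zc t0list`, `Xc = zc e`. [folklore] -/
def accC1 (e L : List ℕ) (u : ZMod 5 × ZMod 5) : ZMod 13 := ∑ t : ZMod 5 × ZMod 5, lamFn L t * momC (zc t0list) (zc e) t u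

/-- **Domino moment certificate check** (decided by the kernel per instance): the test vector `L` isolates `Xs r₀` at hole `sb`. [folklore] -/
def momentCertOK1 (e h L : List ℕ) (r₀ sb : ZMod 5 × ZMod 5) : Bool :=
  decide ((∀ r : ZMod 5 × ZMod 5, gridFn e r ≠ 0 → accB1 h L r = if r = r₀ then 1 else 0) ∧
    (∀ u : ZMod 5 × ZMod 5, gridFn h u ≠ 0 → accC1 e L u = 0) ∧ lamFn L sb = 0)

/-- **Soundness of the domino moment certificate**: from the collected fibre-moment identities with vanishing `W`-block (right-hand side
`0`, hole `sb`) and the support conditions, `Xs r₀ = 0` (provided `r₀` is in the support of `e`). [folklore] -/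
theorem Xs_eq_zero_of_momentCert1 {e h L : List ℕ} {r₀ sb : ZMod 5 × ZMod 5} (hcert : momentCertOK1 e h L r₀ sb = true)
    (hr₀ : gridFn e r₀ ≠ 0) (Ws Xs Ys : ZMod 5 × ZMod 5 → ZMod 13) (s₀ : ZMod 13)
    (hid : ∀ t : ZMod 5 × ZMod 5, (∑ v, Ws v * momA (zc e) (zc h) t v) + (∑ r, Xs r * momB (zc t0list) (zc h) t r) +
      (∑ u, Ys u * momC (zc t0list) (zc e) t u) + (if sb = t then s₀ else 0) = 0)
    (hW0 : ∀ v, Ws v = 0) (hX0 : ∀ r, gridFn e r = 0 → Xs r = 0) (hY0 : ∀ u, gridFn h u = 0 → Ys u = 0) : Xs r₀ = 0 := by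
  have hc := of_decide_eq_true hcert
  obtain ⟨hB, hC, hL⟩ := hc
  have key := moment_pairing (momA (zc e) (zc h)) (momB (zc t0list) (zc h)) (momC (zc t0list) (zc e)) Ws Xs Ys (fun _ => 0)
    sb s₀ hid (lamFn L)
  simp only [mul_zero, sum_const_zero] at key
  rw [hL, zero_mul, add_zero] at key
  have hWblock : (∑ v : ZMod 5 × ZMod 5, Ws v * ∑ t : ZMod 5 × ZMod 5, lamFn L t * momA (zc e) (zc h) t v) = 0 :=
    sum_eq_zero fun v _ => by rw [hW0 v, zero_mul]
  have hYblock : (∑ u : ZMod 5 × ZMod 5, Ys u * ∑ t : ZMod 5 × ZMod 5, lamFn L t * momC (zc t0list) (zc e) t u) = 0 := by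
    refine sum_eq_zero fun u _ => ?_
    by_cases hu : gridFn h u = 0
    · rw [hY0 u hu, zero_mul]
    · have hcu := hC u hu
      unfold accC1 at hcu
      rw [hcu, mul_zero]
  have hXblock : (∑ r : ZMod 5 × ZMod 5, Xs r * ∑ t : ZMod 5 × ZMod 5, lamFn L t * momB (zc t0list) (zc h) t r) = Xs r₀ := by
    rw [Finset.sum_eq_single r₀]
    · have hb := hB r₀ hr₀
      unfold accB1 at hb
      have e1 : (∑ t : ZMod 5 × ZMod 5, lamFn L t * momB (zc t0list) (zc h) t r₀) = 1 := by
        rw [if_pos rfl] at hb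
        rw [← hb]; exact sum_congr rfl fun t _ => by rw [momB_single]
      rw [e1, mul_one]
    · intro r _ hr
      by_cases hre : gridFn e r = 0
      · rw [hX0 r hre, zero_mul]
      · have hb := hB r hre
        unfold accB1 at hb
        have e1 : (∑ t : ZMod 5 × ZMod 5, lamFn L t * momB (zc t0list) (zc h) t r) = 0 := by
          rw [if_neg hr] at hb
          rw [← hb]; exact sum_congr rfl fun t _ => by rw [momB_single]
        rw [e1, mul_zero]
    · intro h'; exact absurd (mem_univ _) h'
  rw [hWblock, hXblock, hYblock, zero_add, add_zero] at key
  exact key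

end Z5Z5ThreeSet

end Summit.MatrixMultiplication.OmegaCensus
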